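import Literature.NumberTheory.LFunctions.RamareLOneEvenSmoothing
import Literature.NumberTheory.LFunctions.RamareLOneHalfLogOdd
import HarnessLib

/-!
# Ramaré 2001, Corollary 3: `|L(1,χ)| ≤ ¼ log q + ½ log 2` (even `χ`), `¼ log q + 5/4 − ½ log 3`
# (odd `χ`) for primitive characters of EVEN conductor `q` — proved

Topic `Literature/NumberTheory/LFunctions`, namespace `Literature.NumberTheory.LFunctions.Ramare2001`.
Everything in this file is PROVED (theorems only; no definition, no named fact; standard axioms).
It discharges the named fact `Literature.NumberTheory.LFunctions.ramare2001_corollary3`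
(`ExplicitLOneUpperBounds.lean`; the `_holds` theorem is appended there):

> **Corollary 3.** Let `χ` be a primitive character of even conductor `q`. Then
> `|L(1, χ)| ≤ ¼ log q + ½ log 2` if `χ(−1) = 1`, and `|L(1, χ)| ≤ ¼ log q + 5/4 − ½ log 3` if
> `χ(−1) = −1`.  (O. Ramaré, Acta Arith. 100 (2001), Corollary 3 p. 248; proof §VII pp. 263–264.)

## The printed proof (§VII) and how it is followed

«Since we assume that `q` is even, we have `χ(n) = 0` as soon as `n` is even which is the additional
information we use in this section.»  EVEN `χ` (p. 263): (7.1)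
`Σ_{n odd} (1 − F₃(δn))/n = Σ_n (1 − F₃(δn))/n − Σ_n (1 − F₃(2δn))/(2n) = −½ log δ − ½ + ½ log 2`
(Lemma 16 twice); Proposition 2 (even) and «Lemmas 11, 7 and 15» give (7.2)
`|L(1,χ)| ≤ −½ log δ − ½ + ½ log 2 + δ√q/2`, «and the choice `δ = 1/√q` yields the estimate».
ODD `χ` (p. 264): `Σ_{n odd} (1 − F₄(δn))/n = −½ log δ + ½ log 2 + 3/4 − ½ log 2π + ∫₀¹ (1−t)
log(πδt/tan πδt) dt` «and this last summand is non-positive» (printed «non-negative», a typo recorded in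
Ramaré's 2004 sequel, p. 143); «Lemma 11 implies `Σ_{m ≤ δq, m odd} (m/(δq) − 1)² ≤ δq/6`», whence
(7.3) `|L(1,χ)| ≤ −½ log δ + ½ log 2 + 3/4 − ½ log 2π + (π/√q)(δq/6)`; «the choice `δ = 3/(π√q)`
concludes the proof.»

The Lean road is the printed one, step by step, on the tree's Proposition 2
(`Ramare2001.LFunction_one_eq_smoothed_add_dual` for `F₃ = H`, `RamareLOneEvenSmoothing.lean`;
`Ramare2001.LFunction_one_eq_fejer_add_dual` for `F₄ = 1 − K`, `RamareLOneOddSmoothing.lean`):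

1. **Lemma 11 (the convexity step), in the form used** (`two_mul_mul_le_integral`,
   `sum_odd_points_le_half_mul_integral`): if `g` is differentiable on `(0,∞)` with NON-DECREASING
   derivative, `g ≥ 0`, `g = 0` on `[1,∞)`, then `g(x) ≤ (2h)⁻¹∫_{x−h}^{x+h} g` (tangent line below the
   graph) and hence `Σ_{k<N} g((2k+1)/α) ≤ (α/2)∫₀¹ g` for every `α > 0` and `N` (the intervals
   `[2k/α, (2k+2)/α]` tile `[0, 2N/α]`).  This is Ramaré's Lemma 11 (p. 256) with `g(1) = 0`.
2. **Lemma 15 and Lemma 7 for the dual kernel `j`** (`vaalerPhi_div_antitoneOn`: `Φ(u)/u =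
   π(1−u)cot πu + 1` is non-increasing on `(0,1]`, since `(sin πu cos πu + π(1−u)) ≥ 0`;
   `vaalerJ_deriv_monotoneOn`: `j' = −2Φ(min(·,1))/y` is non-decreasing on `(0,∞)`, i.e. `j` is convex;
   `integral_vaalerJ`: `∫₀¹ j = 1` from the tree's `j = −2 log − 2R`, `∫₀¹ R = ½`), hence
   `sum_vaalerJ_odd_le`: **`Σ_{k<N} j((2k+1)/α) ≤ α/2`**.
3. The same for the odd dual kernel `P(y) = (1 − y)₊²` (`sum_fejerDualP_odd_le`:
   **`Σ_{k<N} (1 − (2k+1)/α)₊² ≤ α/6`**, `∫₀¹ P = ⅓`).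
4. `χ(n) = 0` for even `n` when `q` is even (`apply_natCast_eq_zero_of_even`), and the reduction of a sum
   over `m < q` weighted by `|χ̄(m+1)|` to the odd points (`sum_norm_mul_le_sum_odd_points`).
5. **(7.1)** (`hasSum_one_sub_vaalerH_div_odd`): `Σ_{n odd} (1 − H(δn))/n = −½ log δ − ½ + ½ log 2`
   for `0 < δ ≤ ½` (Lemma 16 = `hasSum_one_sub_vaalerH_div` at `δ` and `2δ`).
6. **The odd-character smoothed sum** (`tsum_sinc_sq_div_odd_le`): `Σ_{n odd} K(δn)/n =
   Σ_n K(δn)/n − ½Σ_n K(2δn)/n = ∫₀¹ (1−t) log cot(πδt) dt ≤ −½ log(πδ) + ¾` for `0 < δ ≤ ½` (the tree's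
   exact Lemma 17 `tsum_sinc_sq_div_eq_integral` at `δ` and `2δ`, `sin 2x = 2 sin x cos x`, and
   `cot x ≤ 1/x` on `(0, π/2]`).
7. **Assembly** (`norm_LFunction_one_le_quarter_log_add_of_even` with `δ = q^{-1/2}`,
   `norm_LFunction_one_le_quarter_log_add_of_odd` with `δ = 3/(π√q)`; both need only `q ≥ 4`, automatic
   for an even conductor), and `ramare2001_corollary3'` in the quantified shape of the named fact.

Deviations from print: none in the constants or thresholds (the bounds hold for EVERY even conductor);
Lemma 11 is used with `g(1) = 0` only (so its `+g(1)/2` term is absent), proved by the tangent-line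
inequality instead of Ramaré's Lemma 9; the sign of Proposition 2's dual term is immaterial (only
`|τ(χ)| = √q` is used), as in the tree's Corollary 1 files.

## References

* O. Ramaré, *Approximate formulae for `L(1, χ)`*, Acta Arith. 100 (2001) 245–266: Corollary 3 p. 248,
  Lemma 7 p. 253, Lemma 11 p. 256, Lemmas 15–16 p. 259, Lemma 17 p. 260, §VII pp. 263–264.
  [cite: Ramare2001LOneApproximateFormulae, Cor. 3 p. 248 / §VII pp. 263–264]
* O. Ramaré, *Approximate formulae for `L(1, χ)`, II*, Acta Arith. 112 (2004) 141–149, p. 143 (errata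
  to the 2001 paper). [cite: Ramare2004LOneApproximateFormulaeII, p. 143]
* J. D. Vaaler, Bull. AMS 12 (1985) 183–216, Theorem 6. [cite: Vaaler1985, Thm. 6]
-/

noncomputable section

open Real Filter Topology Set MeasureTheory intervalIntegral Finset
open Literature.Analysis.Fourier

namespace Literature.NumberTheory.LFunctions.Ramare2001

/-! ## Step 1: Lemma 11 — a convex function at the odd points `(2k+1)/α` -/

section Convexity

/-- **Tangent line below the graph** for a function on `(0,∞)` whose derivative is non-decreasing:
`g(x) + g'(x)(t − x) ≤ g(t)` for `x, t > 0`. [cite: Ramare2001LOneApproximateFormulae, Lemma 11 p. 256] -/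
theorem tangent_line_le {g D : ℝ → ℝ} (hderiv : ∀ x, 0 < x → HasDerivAt g (D x) x)
    (hD : MonotoneOn D (Ioi 0)) {x t : ℝ} (hx : 0 < x) (ht : 0 < t) :
    g x + D x * (t - x) ≤ g t := by
  set φ : ℝ → ℝ := fun s => g s - D x * (s - x) with hφ
  have hφd : ∀ s, 0 < s → HasDerivAt φ (D s - D x) s := fun s hs => by
    have h1 : HasDerivAt (fun s => D x * (s - x)) (D x * 1) s :=
      ((hasDerivAt_id s).sub_const x).const_mul (D x)
    have h2 := (hderiv s hs).sub h1
    rw [mul_one] at h2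
    exact h2
  suffices hmin : φ x ≤ φ t by
    simp only [hφ, sub_self, mul_zero, sub_zero] at hmin; linarith
  rcases le_total x t with hxt | htx
  · have hmono : MonotoneOn φ (Ici x) := by
      refine monotoneOn_of_deriv_nonneg (convex_Ici x)
        (fun s hs => (hφd s (hx.trans_le hs)).continuousAt.continuousWithinAt)
        (fun s hs => ?_) (fun s hs => ?_)
      · rw [interior_Ici] at hs
        exact (hφd s (hx.trans hs)).differentiableAt.differentiableWithinAt
      · rw [interior_Ici] at hs
        rw [(hφd s (hx.trans hs)).deriv]
        exact sub_nonneg.2 (hD hx (hx.trans hs) (le_of_lt hs))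
    exact hmono Set.self_mem_Ici (Set.mem_Ici.2 hxt) hxt
  · have hanti : AntitoneOn φ (Ioc 0 x) := by
      refine antitoneOn_of_deriv_nonpos (convex_Ioc 0 x)
        (fun s hs => (hφd s hs.1).continuousAt.continuousWithinAt)
        (fun s hs => ?_) (fun s hs => ?_)
      · rw [interior_Ioc] at hs
        exact (hφd s hs.1).differentiableAt.differentiableWithinAt
      · rw [interior_Ioc] at hs
        rw [(hφd s hs.1).deriv]
        exact sub_nonpos.2 (hD hs.1 hx hs.2.le)
    exact hanti (show t ∈ Ioc 0 x from ⟨ht, htx⟩) (show x ∈ Ioc 0 x from ⟨hx, le_rfl⟩) htx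

/-- **Midpoint below the mean** (Hermite–Hadamard, left half): `2h·g(x) ≤ ∫_{x−h}^{x+h} g` for
`0 < h ≤ x` when `g'` is non-decreasing on `(0,∞)`. [cite: Ramare2001LOneApproximateFormulae, Lemma 11 p. 256] -/
theorem two_mul_mul_le_integral {g D : ℝ → ℝ} (hderiv : ∀ x, 0 < x → HasDerivAt g (D x) x)
    (hD : MonotoneOn D (Ioi 0)) {x h : ℝ} (hh : 0 < h) (hhx : h ≤ x)
    (hint : IntervalIntegrable g volume (x - h) (x + h)) :
    2 * h * g x ≤ ∫ t in (x - h)..(x + h), g t := by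
  have hx : 0 < x := lt_of_lt_of_le hh hhx
  have hle : x - h ≤ x + h := by linarith
  have e : (fun t : ℝ => g x + D x * (t - x)) = fun t => D x * t + (g x - D x * x) := by
    funext t; ring
  have h1 : ∫ t in (x - h)..(x + h), (g x + D x * (t - x)) = 2 * h * g x := by
    rw [e, intervalIntegral.integral_add (intervalIntegrable_id.const_mul _) intervalIntegrable_const,
      intervalIntegral.integral_const_mul, integral_id, intervalIntegral.integral_const, smul_eq_mul]
    ring
  rw [← h1]
  refine intervalIntegral.integral_mono_on_of_le_Ioo hle ?_ hint fun t ht => ?_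
  · rw [e]; exact (intervalIntegrable_id.const_mul _).add intervalIntegrable_const
  · exact tangent_line_le hderiv hD hx (by linarith [ht.1])

/-- `Σ_{m<2M} b(m) = Σ_{k<M} (b(2k) + b(2k+1))`. [folklore] -/
private theorem sum_range_two_mul (b : ℕ → ℝ) (M : ℕ) :
    ∑ m ∈ Finset.range (2 * M), b m = ∑ k ∈ Finset.range M, (b (2 * k) + b (2 * k + 1)) := by
  induction M with
  | zero => simp
  | succ M ih =>
    rw [show 2 * (M + 1) = 2 * M + 1 + 1 by ring, Finset.sum_range_succ, Finset.sum_range_succ, ih,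
      Finset.sum_range_succ]
    ring

/-- **Ramaré's Lemma 11 (case `g(1) = 0`), odd points**: if `g` is differentiable on `(0,∞)` with
non-decreasing derivative, `g ≥ 0` there, `g = 0` on `[1,∞)` and `g` is integrable on `[0,1]`, then for
`α > 0` and every `N`, `Σ_{k<N} g((2k+1)/α) ≤ (α/2)∫₀¹ g`.
[cite: Ramare2001LOneApproximateFormulae, Lemma 11 p. 256] -/
theorem sum_odd_points_le_half_mul_integral {g D : ℝ → ℝ}
    (hderiv : ∀ x, 0 < x → HasDerivAt g (D x) x) (hD : MonotoneOn D (Ioi 0))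
    (hg0 : ∀ x, 0 < x → 0 ≤ g x) (hg1 : ∀ x, 1 ≤ x → g x = 0)
    (hint : IntervalIntegrable g volume 0 1) {α : ℝ} (hα : 0 < α) (N : ℕ) :
    ∑ k ∈ Finset.range N, g ((2 * k + 1) / α) ≤ α / 2 * ∫ t in (0:ℝ)..1, g t := by
  -- integrability on every `[a, b]`, `0 ≤ a ≤ b`
  have hU : IntegrableOn g (Ioc 0 1 ∪ Ici 1) volume := by
    refine IntegrableOn.union ?_ ?_
    · exact (intervalIntegrable_iff_integrableOn_Ioc_of_le zero_le_one).1 hint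
    · exact integrableOn_zero.congr_fun (fun x hx => (hg1 x hx).symm) measurableSet_Ici
  have hii : ∀ a b : ℝ, 0 ≤ a → a ≤ b → IntervalIntegrable g volume a b := fun a b ha hab => by
    rw [intervalIntegrable_iff_integrableOn_Ioc_of_le hab]
    exact hU.mono_set fun x hx => (le_or_gt x 1).elim
      (fun h => Or.inl ⟨lt_of_le_of_lt ha hx.1, h⟩) fun h => Or.inr h.le
  set a : ℕ → ℝ := fun k => 2 * (k:ℝ) / α with ha
  -- per term
  have hterm : ∀ k : ℕ, g ((2 * k + 1) / α) ≤ α / 2 * ∫ t in (a k)..(a (k + 1)), g t := by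
    intro k
    have hx : 1 / α ≤ (2 * (k:ℝ) + 1) / α := by
      rw [div_le_div_iff_of_pos_right hα]; have : (0:ℝ) ≤ k := Nat.cast_nonneg k; linarith
    have e1 : (2 * (k:ℝ) + 1) / α - 1 / α = a k := by rw [ha, div_sub_div_same]; ring_nf
    have e2 : (2 * (k:ℝ) + 1) / α + 1 / α = a (k + 1) := by
      rw [ha, ← add_div]; push_cast; ring_nf
    have hak : 0 ≤ a k := by rw [ha]; positivity
    have hakk : a k ≤ a (k + 1) := by
      rw [ha]; push_cast; rw [div_le_div_iff_of_pos_right hα]; linarith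
    have h1 := two_mul_mul_le_integral hderiv hD (x := (2 * (k:ℝ) + 1) / α) (h := 1 / α)
      (by positivity) hx (by rw [e1, e2]; exact hii _ _ hak hakk)
    rw [e1, e2] at h1
    have e3 : g ((2 * (k:ℝ) + 1) / α) = α / 2 * (2 * (1 / α) * g ((2 * (k:ℝ) + 1) / α)) := by
      field_simp
    rw [e3]
    exact mul_le_mul_of_nonneg_left h1 (by positivity)
  -- sum of the tiles
  have hsum : ∑ k ∈ Finset.range N, ∫ t in (a k)..(a (k + 1)), g t = ∫ t in (0:ℝ)..(a N), g t := by
    have h := intervalIntegral.sum_integral_adjacent_intervals (μ := volume) (f := g) (a := a) (n := N)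
      fun k _ => hii _ _ (by rw [ha]; positivity)
        (by rw [ha]; push_cast; rw [div_le_div_iff_of_pos_right hα]; linarith)
    rw [h]; simp [ha]
  -- the total integral is at most `∫₀¹ g`
  have haN : 0 ≤ a N := by rw [ha]; positivity
  have htot : ∫ t in (0:ℝ)..(a N), g t ≤ ∫ t in (0:ℝ)..1, g t := by
    rcases le_or_gt (a N) 1 with h1 | h1
    · refine intervalIntegral.integral_mono_interval le_rfl haN h1 ?_ hint
      exact ae_restrict_of_forall_mem measurableSet_Ioc fun x hx => hg0 x hx.1
    · have hsplit := intervalIntegral.integral_add_adjacent_intervals (hii 0 1 le_rfl zero_le_one)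
        (hii 1 (a N) zero_le_one h1.le)
      have hz : ∫ t in (1:ℝ)..(a N), g t = 0 := by
        rw [intervalIntegral.integral_congr (g := fun _ => (0:ℝ)) fun t ht => ?_]
        · simp
        · rw [Set.uIcc_of_le h1.le] at ht; exact hg1 t ht.1
      linarith
  calc ∑ k ∈ Finset.range N, g ((2 * k + 1) / α)
      ≤ ∑ k ∈ Finset.range N, α / 2 * ∫ t in (a k)..(a (k + 1)), g t :=
        Finset.sum_le_sum fun k _ => hterm k
    _ = α / 2 * ∫ t in (0:ℝ)..(a N), g t := by rw [← Finset.mul_sum, hsum]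
    _ ≤ α / 2 * ∫ t in (0:ℝ)..1, g t := mul_le_mul_of_nonneg_left htot (by positivity)

end Convexity

/-! ## Step 2: Lemma 15 and Lemma 7 for the dual kernel `j`; `Σ_{k<N} j((2k+1)/α) ≤ α/2` -/

section DualKernel

variable {Φ J : ℝ → ℝ}

/-- **Ramaré's Lemma 15 (the monotonicity behind it):** `u ↦ Φ(u)/u = π(1−u)cot(πu) + 1` is
non-increasing on `(0,1]` — its derivative is `−π(sin πu cos πu + π(1−u))/sin² πu ≤ 0`, because
`sin πu cos πu = −½ sin 2π(1−u) ≥ −π(1−u)`. [cite: Ramare2001LOneApproximateFormulae, Lemma 15 p. 259] -/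
theorem vaalerPhi_div_antitoneOn
    (hΦ : Φ = fun u => Real.cos (π * u) / (Real.sinc (π * u) + Real.sinc (π * (1 - u))) + u) :
    AntitoneOn (fun u => Φ u / u) (Ioc (0:ℝ) 1) := by
  -- the closed form on `(0,1)`
  set ψ : ℝ → ℝ := fun u => π * ((1 - u) * (Real.cos (π * u) / Real.sin (π * u))) + 1 with hψ
  have hψeq : ∀ u ∈ Ioo (0:ℝ) 1, Φ u / u = ψ u := by
    intro u hu
    rw [vaalerPhi_eq_of_mem_Ioo hΦ hu, hψ]
    have hu0 : u ≠ 0 := hu.1.ne'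
    field_simp
  have hsin : ∀ u ∈ Ioo (0:ℝ) 1, 0 < Real.sin (π * u) := fun u hu =>
    Real.sin_pos_of_pos_of_lt_pi (by nlinarith [Real.pi_pos, hu.1])
      (by nlinarith [Real.pi_pos, hu.2])
  -- derivative of `ψ`
  have hψd : ∀ u ∈ Ioo (0:ℝ) 1, HasDerivAt ψ
      (π * ((0 - 1) * (Real.cos (π * u) / Real.sin (π * u)) +
        (1 - u) * (-π / Real.sin (π * u) ^ 2))) u := by
    intro u hu
    have hs := hsin u hu
    have hc : HasDerivAt (fun u => Real.cos (π * u)) (-Real.sin (π * u) * (π * 1)) u :=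
      ((hasDerivAt_id' u).const_mul π).cos
    have hsn : HasDerivAt (fun u => Real.sin (π * u)) (Real.cos (π * u) * (π * 1)) u :=
      ((hasDerivAt_id' u).const_mul π).sin
    have hq := hc.fun_div hsn hs.ne'
    have hN : -Real.sin (π * u) * (π * 1) * Real.sin (π * u) -
        Real.cos (π * u) * (Real.cos (π * u) * (π * 1)) = -π := by
      linear_combination (-π) * Real.sin_sq_add_cos_sq (π * u)
    rw [hN] at hq
    have h1u : HasDerivAt (fun u : ℝ => 1 - u) (0 - 1) u :=
      (hasDerivAt_const u (1:ℝ)).sub (hasDerivAt_id' u)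
    exact ((h1u.fun_mul hq).const_mul π).add_const 1
  -- sign of the derivative
  have hψd_nonpos : ∀ u ∈ Ioo (0:ℝ) 1,
      π * ((0 - 1) * (Real.cos (π * u) / Real.sin (π * u)) +
        (1 - u) * (-π / Real.sin (π * u) ^ 2)) ≤ 0 := by
    intro u hu
    have hs := hsin u hu
    have hkey : 0 ≤ Real.sin (π * u) * Real.cos (π * u) + π * (1 - u) := by
      have h2 : Real.sin (π * u) * Real.cos (π * u) = -(Real.sin (2 * (π * (1 - u))) / 2) := by
        rw [show 2 * (π * (1 - u)) = 2 * π - 2 * (π * u) by ring, Real.sin_sub, Real.sin_two_pi,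
          Real.cos_two_pi, Real.sin_two_mul]
        ring
      have h3 : Real.sin (2 * (π * (1 - u))) ≤ 2 * (π * (1 - u)) :=
        Real.sin_le (by nlinarith [Real.pi_pos, hu.2])
      rw [h2]; linarith
    have e : π * ((0 - 1) * (Real.cos (π * u) / Real.sin (π * u)) +
        (1 - u) * (-π / Real.sin (π * u) ^ 2))
        = -(π * (Real.sin (π * u) * Real.cos (π * u) + π * (1 - u))) / Real.sin (π * u) ^ 2 := by
      field_simp
      ring
    rw [e]
    exact div_nonpos_of_nonpos_of_nonneg (neg_nonpos.2 (mul_nonneg Real.pi_pos.le hkey)) (sq_nonneg _)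
  -- `ψ` is antitone on `(0,1)`
  have hψanti : AntitoneOn ψ (Ioo (0:ℝ) 1) := by
    refine antitoneOn_of_deriv_nonpos (convex_Ioo 0 1)
      (fun u hu => (hψd u hu).continuousAt.continuousWithinAt) (fun u hu => ?_) (fun u hu => ?_)
    · rw [interior_Ioo] at hu; exact (hψd u hu).differentiableAt.differentiableWithinAt
    · rw [interior_Ioo] at hu; rw [(hψd u hu).deriv]; exact hψd_nonpos u hu
  -- extend to `(0,1]` using `Φ(1) = 0 ≤ Φ(u)`
  intro u hu v hv huv
  show Φ v / v ≤ Φ u / u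
  rcases hv.2.eq_or_lt with h1 | h1
  · rw [h1, (vaalerPhi_zero_one hΦ).2, zero_div]
    exact div_nonneg (vaalerPhi_mem_Icc hΦ ⟨hu.1.le, hu.2⟩).1 hu.1.le
  · have hu1 : u < 1 := lt_of_le_of_lt huv h1
    rw [hψeq u ⟨hu.1, hu1⟩, hψeq v ⟨hv.1, h1⟩]
    exact hψanti ⟨hu.1, hu1⟩ ⟨hv.1, h1⟩ huv

/-- **`j` is convex on `(0,∞)`**: its derivative `−2Φ(min(y,1))/y` is non-decreasing (Lemma 15:
«`j'` is non-positive and non-decreasing over `[0,1]`»; and `j' = 0` on `[1,∞)`).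
[cite: Ramare2001LOneApproximateFormulae, Lemma 15 p. 259] -/
theorem vaalerJ_deriv_monotoneOn
    (hΦ : Φ = fun u => Real.cos (π * u) / (Real.sinc (π * u) + Real.sinc (π * (1 - u))) + u) :
    MonotoneOn (fun y : ℝ => -(2 * Φ (min y 1) / y)) (Ioi (0:ℝ)) := by
  intro a ha b hb hab
  have ha0 : 0 < a := ha
  have hb0 : 0 < b := hb
  simp only
  rcases le_or_gt b 1 with hb1 | hb1
  · have ha1 : a ≤ 1 := hab.trans hb1
    rw [min_eq_left ha1, min_eq_left hb1]
    have h := vaalerPhi_div_antitoneOn hΦ ⟨ha0, ha1⟩ ⟨hb0, hb1⟩ hab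
    have e : ∀ y : ℝ, -(2 * Φ y / y) = -2 * (Φ y / y) := fun y => by ring
    rw [e, e]
    linarith
  · rw [min_eq_right hb1.le, (vaalerPhi_zero_one hΦ).2, mul_zero, zero_div, neg_zero]
    have : 0 ≤ Φ (min a 1) :=
      (vaalerPhi_mem_Icc hΦ ⟨le_min ha0.le zero_le_one, min_le_right _ _⟩).1
    exact neg_nonpos.2 (div_nonneg (by linarith) ha0.le)

/-- `j` is integrable on `[0,1]` (`j = −2 log − 2R` with `R` continuous on `[0,∞)`).
[cite: Ramare2001LOneApproximateFormulae, Lemma 7 p. 253] -/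
theorem intervalIntegrable_vaalerJ
    (hΦ : Φ = fun u => Real.cos (π * u) / (Real.sinc (π * u) + Real.sinc (π * (1 - u))) + u)
    (hJ : J = fun y => 2 * ∫ u in y..1, Φ (min u 1) / u) :
    IntervalIntegrable J volume 0 1 := by
  set R : ℝ → ℝ := fun y => ∫ u in (min y 1)..1, (1 - Φ u) / u with hR
  have hRi : IntervalIntegrable R volume 0 1 :=
    ((continuousOn_vaalerR hΦ hR).mono Icc_subset_Ici_self).intervalIntegrable_of_Icc zero_le_one
  have hLi : IntervalIntegrable (fun y => -2 * Real.log y - 2 * R y) volume 0 1 :=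
    (intervalIntegrable_log'.const_mul (-2)).sub (hRi.const_mul 2)
  rw [intervalIntegrable_iff_integrableOn_Ioc_of_le zero_le_one] at hLi ⊢
  exact hLi.congr_fun (fun y hy => (vaalerJ_eq_log hΦ hJ hR hy.1 hy.2).symm) measurableSet_Ioc

/-- **`∫₀¹ j = 1`** (Ramaré's Lemma 7: `j ∈ L¹`, `∫ j = 1`; here from `j = −2 log y − 2R(y)`,
`∫₀¹ log = −1`, `∫₀¹ R = ½`). [cite: Ramare2001LOneApproximateFormulae, Lemma 7 p. 253] -/
theorem integral_vaalerJ
    (hΦ : Φ = fun u => Real.cos (π * u) / (Real.sinc (π * u) + Real.sinc (π * (1 - u))) + u)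
    (hJ : J = fun y => 2 * ∫ u in y..1, Φ (min u 1) / u) :
    ∫ y in (0:ℝ)..1, J y = 1 := by
  set R : ℝ → ℝ := fun y => ∫ u in (min y 1)..1, (1 - Φ u) / u with hR
  have hRi : IntervalIntegrable R volume 0 1 :=
    ((continuousOn_vaalerR hΦ hR).mono Icc_subset_Ici_self).intervalIntegrable_of_Icc zero_le_one
  have h1 : ∫ y in (0:ℝ)..1, J y = ∫ y in (0:ℝ)..1, (-2 * Real.log y - 2 * R y) := by
    refine intervalIntegral.integral_congr_ae ?_
    refine Eventually.of_forall fun y hy => ?_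
    rw [Set.uIoc_of_le zero_le_one] at hy
    exact vaalerJ_eq_log hΦ hJ hR hy.1 hy.2
  rw [h1, intervalIntegral.integral_sub (intervalIntegrable_log'.const_mul (-2)) (hRi.const_mul 2),
    intervalIntegral.integral_const_mul, intervalIntegral.integral_const_mul, integral_log,
    integral_vaalerR hΦ hR]
  simp
  norm_num

/-- **`Σ_{k<N} j((2k+1)/α) ≤ α/2`** for every `α > 0` («we gather Lemmas 11, 7 and 15», p. 263).
[cite: Ramare2001LOneApproximateFormulae, §VII p. 263 (7.2)] -/
theorem sum_vaalerJ_odd_le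
    (hΦ : Φ = fun u => Real.cos (π * u) / (Real.sinc (π * u) + Real.sinc (π * (1 - u))) + u)
    (hJ : J = fun y => 2 * ∫ u in y..1, Φ (min u 1) / u) {α : ℝ} (hα : 0 < α) (N : ℕ) :
    ∑ k ∈ Finset.range N, J ((2 * k + 1) / α) ≤ α / 2 := by
  have h := sum_odd_points_le_half_mul_integral (g := J) (D := fun y => -(2 * Φ (min y 1) / y))
    (fun x hx => hasDerivAt_vaalerJ hΦ hJ hx) (vaalerJ_deriv_monotoneOn hΦ)
    (fun x hx => vaalerJ_nonneg hΦ hJ hx) (fun x hx => vaalerJ_eq_zero hΦ hJ hx)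
    (intervalIntegrable_vaalerJ hΦ hJ) hα N
  rw [integral_vaalerJ hΦ hJ, mul_one] at h
  exact h

end DualKernel

/-! ## Step 3: the odd dual kernel `P(y) = (1 − y)₊²`; `Σ_{k<N} P((2k+1)/α) ≤ α/6` -/

section FejerDual

variable {P : ℝ → ℝ}

/-- `∫₀¹ P = ⅓`. [cite: Ramare2001LOneApproximateFormulae, §VII p. 264] -/
theorem integral_fejerDualP (hP : P = fun y => ∫ u in y..1, 2 * (1 - min u 1)) :
    ∫ y in (0:ℝ)..1, P y = 1 / 3 := by
  rw [intervalIntegral.integral_congr (g := fun y => (1 - y) ^ 2) fun y hy => ?_]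
  · have h := intervalIntegral.integral_comp_sub_left (fun y : ℝ => y ^ 2) (1:ℝ) (a := 0) (b := 1)
    simp only [sub_zero, sub_self] at h
    rw [h, integral_pow]; norm_num
  · rw [Set.uIcc_of_le zero_le_one] at hy
    exact fejerDualP_eq hP hy.2

/-- **`Σ_{k<N} (1 − (2k+1)/α)₊² ≤ α/6`** for every `α > 0` («Lemma 11 implies
`Σ_{m ≤ δq, m odd} (m/(δq) − 1)² ≤ δq/6`», p. 264). [cite: Ramare2001LOneApproximateFormulae, §VII p. 264] -/
theorem sum_fejerDualP_odd_le (hP : P = fun y => ∫ u in y..1, 2 * (1 - min u 1)) {α : ℝ}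
    (hα : 0 < α) (N : ℕ) : ∑ k ∈ Finset.range N, P ((2 * k + 1) / α) ≤ α / 6 := by
  have hcont : Continuous P :=
    continuous_iff_continuousAt.2 fun y => (hasDerivAt_fejerDualP hP y).continuousAt
  have hmono : MonotoneOn (fun y : ℝ => -(2 * (1 - min y 1))) (Ioi (0:ℝ)) := by
    intro a _ b _ hab
    have : min a 1 ≤ min b 1 := min_le_min_right 1 hab
    simp only; linarith
  have h := sum_odd_points_le_half_mul_integral (g := P) (D := fun y => -(2 * (1 - min y 1)))
    (fun x _ => hasDerivAt_fejerDualP hP x) hmono (fun x _ => fejerDualP_nonneg hP x)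
    (fun x hx => fejerDualP_eq_zero hP hx) (hcont.intervalIntegrable 0 1) hα N
  rw [integral_fejerDualP hP] at h
  linarith

end FejerDual

/-! ## Step 4: characters of even conductor vanish at even arguments -/

section EvenModulus

variable {q : ℕ} (χ : DirichletCharacter ℂ q)

/-- «Since `q` is even, `χ(n) = 0` as soon as `n` is even.» [cite: Ramare2001LOneApproximateFormulae, §VII p. 263] -/
theorem apply_natCast_eq_zero_of_even (hq : Even q) {n : ℕ} (hn : Even n) :
    χ (n : ZMod q) = 0 := by
  apply χ.map_nonunit
  rw [ZMod.isUnit_iff_coprime]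
  intro hcop
  have h2 : 2 ∣ Nat.gcd n q := Nat.dvd_gcd hn.two_dvd hq.two_dvd
  rw [hcop] at h2
  norm_num at h2

/-- Reduction of a `|χ̄|`-weighted sum over `1 ≤ m+1 ≤ q` to the odd points, for even `q` and a
non-negative weight: `Σ_{m<q} |χ̄(m+1)| g((m+1)/α) ≤ Σ_{k<q} g((2k+1)/α)`.
[cite: Ramare2001LOneApproximateFormulae, §VII p. 263] -/
theorem sum_norm_mul_le_sum_odd_points (hq : Even q) {g : ℝ → ℝ} (hg : ∀ y, 0 < y → 0 ≤ g y)
    {α : ℝ} (hα : 0 < α) :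
    ∑ m ∈ Finset.range q, ‖χ⁻¹ ((m + 1 : ℕ) : ZMod q)‖ * g ((m + 1) / α)
      ≤ ∑ k ∈ Finset.range q, g ((2 * k + 1) / α) := by
  set b : ℕ → ℝ := fun m => ‖χ⁻¹ ((m + 1 : ℕ) : ZMod q)‖ * g (((m:ℝ) + 1) / α) with hb
  have hbnn : ∀ m, 0 ≤ b m := fun m => mul_nonneg (norm_nonneg _) (hg _ (by positivity))
  have h1 : ∑ m ∈ Finset.range q, b m ≤ ∑ m ∈ Finset.range (2 * q), b m :=
    Finset.sum_le_sum_of_subset_of_nonneg (Finset.range_mono (Nat.le_mul_of_pos_left q two_pos))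
      fun m _ _ => hbnn m
  have h2 : ∑ m ∈ Finset.range (2 * q), b m = ∑ k ∈ Finset.range q, (b (2 * k) + b (2 * k + 1)) :=
    sum_range_two_mul b q
  have h3 : ∀ k, b (2 * k) + b (2 * k + 1) ≤ g ((2 * k + 1) / α) := by
    intro k
    have hz : χ⁻¹ ((2 * k + 1 + 1 : ℕ) : ZMod q) = 0 :=
      apply_natCast_eq_zero_of_even χ⁻¹ hq ⟨k + 1, by ring⟩
    have hb1 : b (2 * k + 1) = 0 := by
      simp only [hb]; rw [hz, norm_zero, zero_mul]
    have hb0 : b (2 * k) ≤ g ((2 * k + 1) / α) := by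
      simp only [hb]
      have e : ((2 * k : ℕ) : ℝ) + 1 = 2 * k + 1 := by push_cast; ring
      rw [e]
      exact mul_le_of_le_one_left (hg _ (by positivity)) (DirichletCharacter.norm_le_one _ _)
    linarith
  calc ∑ m ∈ Finset.range q, ‖χ⁻¹ ((m + 1 : ℕ) : ZMod q)‖ * g ((m + 1) / α)
      = ∑ m ∈ Finset.range q, b m := by simp only [hb]
    _ ≤ ∑ k ∈ Finset.range q, (b (2 * k) + b (2 * k + 1)) := h1.trans_eq h2
    _ ≤ ∑ k ∈ Finset.range q, g ((2 * k + 1) / α) := Finset.sum_le_sum fun k _ => h3 k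

/-- There is no non-trivial Dirichlet character mod `2` (`(ℤ/2)ˣ` is trivial); hence an even conductor
carrying a character `χ ≠ 1` is at least `4`. [folklore] -/
private theorem four_le_of_even_of_ne_one [NeZero q] (hq : Even q) (hχ1 : χ ≠ 1) : 4 ≤ q := by
  have hq0 : q ≠ 0 := NeZero.ne q
  by_contra hlt
  have hq2 : q = 2 := by
    obtain ⟨r, hr⟩ := hq
    omega
  subst hq2
  apply hχ1
  refine MulChar.ext fun u => ?_
  have key : ∀ x : ZMod 2, x ≠ 0 → x = 1 := by decide
  rw [key (u : ZMod 2) u.ne_zero, map_one, map_one]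

end EvenModulus

/-! ## Step 5: (7.1) — the even-character smoothed sum over odd `n` -/

section SmoothedEven

/-- **(7.1)**: for `0 < δ`, `2δ ≤ 1`,
`Σ_{n odd} (1 − H(δn))/n = Σ_n (1 − H(δn))/n − Σ_n (1 − H(2δn))/(2n) = −½ log δ − ½ + ½ log 2`
(Lemma 16 at `δ` and at `2δ`), as a `HasSum` over `ℕ` supported on even indices `n` (`n + 1` odd).
[cite: Ramare2001LOneApproximateFormulae, §VII (7.1) p. 263] -/
theorem hasSum_one_sub_vaalerH_div_odd {δ : ℝ} (hδ : 0 < δ) (hδ2 : 2 * δ ≤ 1) :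
    HasSum (fun n : ℕ => if Even n then
        (1 - (beurlingReal (δ * (n + 1)) - Real.sinc (π * (δ * (n + 1))) ^ 2)) / (n + 1) else 0)
      (-Real.log δ / 2 - 1 / 2 + Real.log 2 / 2) := by
  set w : ℕ → ℝ := fun n =>
    (1 - (beurlingReal (δ * (n + 1)) - Real.sinc (π * (δ * (n + 1))) ^ 2)) / (n + 1) with hw
  have hδ1 : δ ≤ 1 := by linarith
  have hS : HasSum w (-Real.log δ - 1 + δ) := hasSum_one_sub_vaalerH_div hδ hδ1
  -- odd indices: `w (2k+1) = ½ · w_{2δ}(k)`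
  have e : ∀ k : ℕ, w (2 * k + 1) =
      (1 - (beurlingReal (2 * δ * (k + 1)) - Real.sinc (π * (2 * δ * (k + 1))) ^ 2)) / (k + 1) / 2 := by
    intro k
    simp only [hw]
    have e1 : (δ * (((2 * k + 1 : ℕ) : ℝ) + 1) : ℝ) = 2 * δ * (k + 1) := by push_cast; ring
    have e2 : ((2 * k + 1 : ℕ) : ℝ) + 1 = ((k:ℝ) + 1) * 2 := by push_cast; ring
    rw [e1, e2, div_div]
  have hO : HasSum (fun k : ℕ => w (2 * k + 1)) ((-Real.log (2 * δ) - 1 + 2 * δ) / 2) := by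
    have h2 := (hasSum_one_sub_vaalerH_div (by positivity : 0 < 2 * δ) hδ2).div_const 2
    rw [show (fun k : ℕ => w (2 * k + 1)) = fun k : ℕ =>
      (1 - (beurlingReal (2 * δ * (k + 1)) - Real.sinc (π * (2 * δ * (k + 1))) ^ 2)) / (k + 1) / 2
      from funext e]
    exact h2
  -- even indices
  have hEs : Summable (fun k : ℕ => w (2 * k)) :=
    hS.summable.comp_injective (mul_right_injective₀ (two_ne_zero' ℕ))
  obtain ⟨A, hA⟩ := hEs
  have hAval : A = (-Real.log δ - 1 + δ) - (-Real.log (2 * δ) - 1 + 2 * δ) / 2 := by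
    have := hS.unique (HasSum.even_add_odd hA hO); linarith
  -- the function supported on even indices
  set g : ℕ → ℝ := fun n => if Even n then w n else 0 with hg
  have hE' : HasSum (fun k : ℕ => g (2 * k)) A := by
    have : (fun k : ℕ => g (2 * k)) = fun k => w (2 * k) := by
      funext k; simp only [hg, even_two_mul, if_true]
    rw [this]; exact hA
  have hO' : HasSum (fun k : ℕ => g (2 * k + 1)) 0 := by
    have : (fun k : ℕ => g (2 * k + 1)) = fun _ => 0 := by
      funext k; simp only [hg, Nat.not_even_two_mul_add_one, if_false]
    rw [this]; exact hasSum_zero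
  have h := HasSum.even_add_odd hE' hO'
  rw [add_zero, hAval, Real.log_mul two_ne_zero hδ.ne'] at h
  have ev : -Real.log δ - 1 + δ - (-(Real.log 2 + Real.log δ) - 1 + 2 * δ) / 2
      = -Real.log δ / 2 - 1 / 2 + Real.log 2 / 2 := by ring
  rw [ev] at h
  exact h

end SmoothedEven

/-! ## Step 6: the odd-character smoothed sum over odd `n` -/

section SmoothedOdd

/-- `∫₀¹ t log t dt = −1/4`. [folklore] -/
private theorem integral_id_mul_log' : ∫ t in (0:ℝ)..1, t * Real.log t = -1 / 4 := by
  have hcont : ContinuousOn (fun t : ℝ => t / 2 * (t * Real.log t) - t ^ 2 / 4) (Icc 0 1) := by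
    have := Real.continuous_mul_log
    fun_prop
  have hderiv : ∀ t ∈ Ioo (0:ℝ) 1,
      HasDerivAt (fun t : ℝ => t / 2 * (t * Real.log t) - t ^ 2 / 4) (t * Real.log t) t := by
    intro t ht
    have h := (((hasDerivAt_id t).div_const 2).mul (Real.hasDerivAt_mul_log ht.1.ne')).sub
      ((hasDerivAt_pow 2 t).div_const 4)
    refine h.congr_deriv ?_
    simp only [id, Nat.cast_ofNat]
    ring
  rw [intervalIntegral.integral_eq_sub_of_hasDerivAt_of_le zero_le_one hcont hderiv
    ((intervalIntegrable_log'.continuousOn_mul (by fun_prop)))]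
  norm_num

/-- `t ↦ (1 − t) log sin(π c t)` is integrable on `[0,1]` for `c > 0`.
[cite: Ramare2001LOneApproximateFormulae, Lemma 17 p. 260] -/
theorem intervalIntegrable_one_sub_mul_log_sin {c : ℝ} (hc : 0 < c) :
    IntervalIntegrable (fun t => (1 - t) * Real.log (Real.sin (π * (c * t)))) volume 0 1 := by
  have h := (intervalIntegrable_log_sin (a := 0) (b := π * c)).comp_mul_left (c := π * c)
  have hπc : π * c ≠ 0 := by positivity
  have h' : IntervalIntegrable (fun t => Real.log (Real.sin (π * (c * t)))) volume 0 1 := by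
    have e : (fun t => Real.log (Real.sin (π * (c * t)))) =
        fun t => (Real.log ∘ Real.sin) (π * c * t) := by
      funext t; simp [mul_assoc]
    rw [e]; simpa [hπc] using h
  exact h'.continuousOn_mul (by fun_prop)

/-- **The doubling step**: for `0 < δ < ½`,
`∫₀¹ (1−t) log sin 2πδt dt − 2∫₀¹ (1−t) log sin πδt dt ≤ ½ log 2 − ½ log πδ + ¾`
(`log sin 2x − 2 log sin x = log 2 + log cot x ≤ log 2 − log x` on `(0, π/2)`, and
`∫₀¹ (1−t) log t dt = −¾`). [cite: Ramare2001LOneApproximateFormulae, §VII p. 264] -/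
theorem integral_log_sin_double_sub_le {δ : ℝ} (hδ : 0 < δ) (hδ2 : δ < 1 / 2) :
    (∫ t in (0:ℝ)..1, (1 - t) * Real.log (Real.sin (π * (2 * δ * t))))
      - 2 * (∫ t in (0:ℝ)..1, (1 - t) * Real.log (Real.sin (π * (δ * t))))
      ≤ Real.log 2 / 2 - Real.log (π * δ) / 2 + 3 / 4 := by
  have hI2 := intervalIntegrable_one_sub_mul_log_sin (by positivity : 0 < 2 * δ)
  have hI1 := intervalIntegrable_one_sub_mul_log_sin hδ
  have hπδ : 0 < π * δ := by positivity
  -- left side as one integral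
  have hL : (∫ t in (0:ℝ)..1, (1 - t) * Real.log (Real.sin (π * (2 * δ * t))))
      - 2 * (∫ t in (0:ℝ)..1, (1 - t) * Real.log (Real.sin (π * (δ * t))))
      = ∫ t in (0:ℝ)..1, ((1 - t) * Real.log (Real.sin (π * (2 * δ * t)))
          - 2 * ((1 - t) * Real.log (Real.sin (π * (δ * t))))) := by
    rw [intervalIntegral.integral_sub hI2 (hI1.const_mul 2), intervalIntegral.integral_const_mul]
  -- right side as one integral
  have hRi : IntervalIntegrable (fun t => (1 - t) * (Real.log 2 - Real.log (π * δ) - Real.log t))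
      volume 0 1 :=
    (intervalIntegrable_const.sub intervalIntegrable_log').continuousOn_mul (by fun_prop)
  have hR : ∫ t in (0:ℝ)..1, (1 - t) * (Real.log 2 - Real.log (π * δ) - Real.log t)
      = Real.log 2 / 2 - Real.log (π * δ) / 2 + 3 / 4 := by
    have e : (fun t : ℝ => (1 - t) * (Real.log 2 - Real.log (π * δ) - Real.log t))
        = fun t => ((Real.log 2 - Real.log (π * δ)) - (Real.log 2 - Real.log (π * δ)) * t)
            - (Real.log t - t * Real.log t) := by
      funext t; ring
    rw [e, intervalIntegral.integral_sub ((intervalIntegrable_const).sub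
        (intervalIntegrable_id.const_mul _))
        (intervalIntegrable_log'.sub (intervalIntegrable_log'.continuousOn_mul (by fun_prop))),
      intervalIntegral.integral_sub intervalIntegrable_const (intervalIntegrable_id.const_mul _),
      intervalIntegral.integral_sub intervalIntegrable_log'
        (intervalIntegrable_log'.continuousOn_mul (by fun_prop)),
      intervalIntegral.integral_const, intervalIntegral.integral_const_mul, integral_id,
      integral_log, integral_id_mul_log']
    simp
    ring
  rw [hL, ← hR]
  refine intervalIntegral.integral_mono_on_of_le_Ioo zero_le_one (hI2.sub (hI1.const_mul 2)) hRi
    fun t ht => ?_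
  -- pointwise on `(0,1)`: with `x = πδt ∈ (0, π/2)`
  set x : ℝ := π * (δ * t) with hx
  have hx0 : 0 < x := by rw [hx]; exact mul_pos Real.pi_pos (mul_pos hδ ht.1)
  have hx2 : x < π / 2 := by
    rw [hx]
    have : δ * t < 1 / 2 := by nlinarith [ht.2]
    nlinarith [Real.pi_pos]
  have hsin : 0 < Real.sin x := Real.sin_pos_of_pos_of_lt_pi hx0 (by linarith [Real.pi_pos])
  have hcos : 0 < Real.cos x := Real.cos_pos_of_mem_Ioo ⟨by linarith, hx2⟩
  have h2x : Real.sin (π * (2 * δ * t)) = 2 * Real.sin x * Real.cos x := by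
    rw [show π * (2 * δ * t) = 2 * x by rw [hx]; ring, Real.sin_two_mul]
  have hlog2x : Real.log (Real.sin (π * (2 * δ * t)))
      = Real.log 2 + Real.log (Real.sin x) + Real.log (Real.cos x) := by
    rw [h2x, Real.log_mul (by positivity) hcos.ne', Real.log_mul two_ne_zero hsin.ne']
  -- `log cos x − log sin x ≤ −log x` from `x cos x ≤ sin x`
  have htan : x * Real.cos x ≤ Real.sin x := by
    have h := Real.le_tan hx0.le hx2
    rw [Real.tan_eq_sin_div_cos, le_div_iff₀ hcos] at h
    exact h
  have hlogle : Real.log (Real.cos x) + Real.log x ≤ Real.log (Real.sin x) := by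
    rw [← Real.log_mul hcos.ne' hx0.ne']
    exact Real.log_le_log (by positivity) (by linarith [mul_comm x (Real.cos x)])
  have hlogx : Real.log x = Real.log (π * δ) + Real.log t := by
    rw [hx, show π * (δ * t) = π * δ * t by ring, Real.log_mul hπδ.ne' ht.1.ne']
  have h1t : 0 ≤ 1 - t := by linarith [ht.2]
  rw [hlog2x]
  have : Real.log 2 + Real.log (Real.sin x) + Real.log (Real.cos x) - 2 * Real.log (Real.sin x)
      ≤ Real.log 2 - Real.log (π * δ) - Real.log t := by linarith
  calc (1 - t) * (Real.log 2 + Real.log (Real.sin x) + Real.log (Real.cos x))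
        - 2 * ((1 - t) * Real.log (Real.sin x))
      = (1 - t) * (Real.log 2 + Real.log (Real.sin x) + Real.log (Real.cos x)
          - 2 * Real.log (Real.sin x)) := by ring
    _ ≤ (1 - t) * (Real.log 2 - Real.log (π * δ) - Real.log t) :=
        mul_le_mul_of_nonneg_left this h1t

/-- **The odd-character smoothed sum over odd `n`**: for `0 < δ < ½` there is `A` with
`Σ_{n odd} K(δn)/n = A ≤ −½ log(πδ) + ¾` (a `HasSum` over `ℕ` supported on even indices `n`,
`n + 1` odd; `Σ_{n odd} = Σ_n − ½Σ_n(2δ)`, Lemma 17 in its exact form at `δ` and `2δ`).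
[cite: Ramare2001LOneApproximateFormulae, §VII p. 264] -/
theorem exists_hasSum_sinc_sq_div_odd_le {δ : ℝ} (hδ : 0 < δ) (hδ2 : δ < 1 / 2) :
    ∃ A : ℝ, HasSum (fun n : ℕ => if Even n then
        Real.sinc (π * (δ * (n + 1))) ^ 2 / (n + 1) else 0) A ∧
      A ≤ -Real.log (π * δ) / 2 + 3 / 4 := by
  set w : ℕ → ℝ := fun n => Real.sinc (π * (δ * (n + 1))) ^ 2 / (n + 1) with hw
  have hδ1 : δ < 1 := by linarith
  have h2δ0 : 0 < 2 * δ := by positivity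
  have h2δ1 : 2 * δ < 1 := by linarith
  have hS : HasSum w (∑' n, w n) := (summable_sinc_sq_div hδ).hasSum
  have hS2 : HasSum (fun n : ℕ => Real.sinc (π * (2 * δ * (n + 1))) ^ 2 / (n + 1))
      (∑' n : ℕ, Real.sinc (π * (2 * δ * (n + 1))) ^ 2 / (n + 1)) := (summable_sinc_sq_div h2δ0).hasSum
  -- odd indices
  have e : ∀ k : ℕ, w (2 * k + 1) = Real.sinc (π * (2 * δ * (k + 1))) ^ 2 / (k + 1) / 2 := by
    intro k
    simp only [hw]
    have e1 : (δ * (((2 * k + 1 : ℕ) : ℝ) + 1) : ℝ) = 2 * δ * (k + 1) := by push_cast; ring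
    have e2 : ((2 * k + 1 : ℕ) : ℝ) + 1 = ((k:ℝ) + 1) * 2 := by push_cast; ring
    rw [e1, e2, div_div]
  have hO : HasSum (fun k : ℕ => w (2 * k + 1))
      ((∑' n : ℕ, Real.sinc (π * (2 * δ * (n + 1))) ^ 2 / (n + 1)) / 2) := by
    have h2 := hS2.div_const 2
    rw [show (fun k : ℕ => w (2 * k + 1)) = fun k : ℕ =>
      Real.sinc (π * (2 * δ * (k + 1))) ^ 2 / (k + 1) / 2 from funext e]
    exact h2
  have hEs : Summable (fun k : ℕ => w (2 * k)) :=
    hS.summable.comp_injective (mul_right_injective₀ (two_ne_zero' ℕ))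
  obtain ⟨A, hA⟩ := hEs
  have hAval : A = (∑' n, w n) - (∑' n : ℕ, Real.sinc (π * (2 * δ * (n + 1))) ^ 2 / (n + 1)) / 2 := by
    have := hS.unique (HasSum.even_add_odd hA hO); linarith
  refine ⟨A, ?_, ?_⟩
  · set g : ℕ → ℝ := fun n => if Even n then w n else 0 with hg
    have hE' : HasSum (fun k : ℕ => g (2 * k)) A := by
      have : (fun k : ℕ => g (2 * k)) = fun k => w (2 * k) := by
        funext k; simp only [hg, even_two_mul, if_true]
      rw [this]; exact hA
    have hO' : HasSum (fun k : ℕ => g (2 * k + 1)) 0 := by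
      have : (fun k : ℕ => g (2 * k + 1)) = fun _ => 0 := by
        funext k; simp only [hg, Nat.not_even_two_mul_add_one, if_false]
      rw [this]; exact hasSum_zero
    have h := HasSum.even_add_odd hE' hO'
    rw [add_zero] at h
    exact h
  · -- the value, through Lemma 17 in exact form at `δ` and `2δ`
    have h1 : (∑' n, w n) = 2 * (∫ t in (0:ℝ)..1, (1 - t) * Real.log (Real.sin (π * t)))
        - 2 * ∫ t in (0:ℝ)..1, (1 - t) * Real.log (Real.sin (π * (δ * t))) :=
      tsum_sinc_sq_div_eq_integral hδ hδ1
    have h2 : (∑' n : ℕ, Real.sinc (π * (2 * δ * (n + 1))) ^ 2 / (n + 1))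
        = 2 * (∫ t in (0:ℝ)..1, (1 - t) * Real.log (Real.sin (π * t)))
          - 2 * ∫ t in (0:ℝ)..1, (1 - t) * Real.log (Real.sin (π * (2 * δ * t))) :=
      tsum_sinc_sq_div_eq_integral h2δ0 h2δ1
    have h3 := two_mul_integral_one_sub_mul_log_sin
    have h4 := integral_log_sin_double_sub_le hδ hδ2
    rw [hAval, h1, h2]
    linarith

end SmoothedOdd

/-! ## Step 7: Corollary 3 -/

section Corollary

variable {q : ℕ} [NeZero q] (χ : DirichletCharacter ℂ q)

/-- **Ramaré 2001, Corollary 3 (even characters):** for an even primitive `χ ≠ 1` of EVEN conductor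
`q`, `|L(1,χ)| ≤ ¼ log q + ½ log 2` — Proposition 2 (`F₃ = H`) at `δ = q^{-1/2}`, (7.1), and the
odd-point dual-sum bound `Σ_{m odd} j(m/√q) ≤ √q/2`. [cite: Ramare2001LOneApproximateFormulae, Cor. 3 p. 248 / (7.2) p. 263] -/
theorem norm_LFunction_one_le_quarter_log_add_of_even (hχ : χ.IsPrimitive) (hχ1 : χ ≠ 1)
    (heven : χ.Even) (hq : Even q) :
    ‖χ.LFunction 1‖ ≤ Real.log q / 4 + Real.log 2 / 2 := by
  have hqne : q ≠ 0 := NeZero.ne q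
  have hq4 : 4 ≤ q := four_le_of_even_of_ne_one χ hq hχ1
  have hq0 : (0:ℝ) < q := by positivity
  have hq4' : (4:ℝ) ≤ q := by exact_mod_cast hq4
  set Φ : ℝ → ℝ := fun u => Real.cos (π * u) / (Real.sinc (π * u) + Real.sinc (π * (1 - u))) + u
    with hΦ
  set J : ℝ → ℝ := fun y => 2 * ∫ u in y..1, Φ (min u 1) / u with hJ
  set s : ℝ := Real.sqrt q with hs
  have hs0 : 0 < s := Real.sqrt_pos.2 hq0
  have hsq : s ^ 2 = q := Real.sq_sqrt hq0.le
  have hs2 : 2 ≤ s := by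
    rw [hs, show (2:ℝ) = Real.sqrt (2 ^ 2) by rw [Real.sqrt_sq]; norm_num]
    exact Real.sqrt_le_sqrt (by linarith)
  set δ : ℝ := 1 / s with hδ
  have hδ0 : 0 < δ := by positivity
  have hδ2 : 2 * δ ≤ 1 := by
    rw [hδ, mul_one_div, div_le_one hs0]; exact hs2
  have hδ1 : δ < 1 := by linarith
  have hδq : δ * q = s := by rw [hδ, ← hsq]; field_simp
  have hformula := LFunction_one_eq_smoothed_add_dual χ hχ hχ1 heven hΦ hJ hδ0 hδ1
  -- the smoothed sum: only odd `n` contribute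
  have hA : ‖∑' n : ℕ, χ ((n + 1 : ℕ) : ZMod q) *
      (((1 - (beurlingReal (δ * (n + 1)) - Real.sinc (π * (δ * (n + 1))) ^ 2)) / (n + 1) : ℝ) : ℂ)‖
        ≤ -Real.log δ / 2 - 1 / 2 + Real.log 2 / 2 := by
    refine tsum_of_norm_bounded (hasSum_one_sub_vaalerH_div_odd hδ0 hδ2) fun n => ?_
    have hwn : 0 ≤ (1 - (beurlingReal (δ * (n + 1)) - Real.sinc (π * (δ * (n + 1))) ^ 2)) / ((n:ℝ) + 1) :=
      div_nonneg (one_sub_beurlingReal_sub_sinc_sq_nonneg (by positivity)) (by positivity)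
    by_cases hn : Even n
    · rw [if_pos hn, norm_mul, Complex.norm_real, Real.norm_eq_abs, abs_of_nonneg hwn]
      exact mul_le_of_le_one_left hwn (χ.norm_le_one _)
    · rw [if_neg hn]
      have hodd : Odd n := Nat.not_even_iff_odd.1 hn
      rw [apply_natCast_eq_zero_of_even χ hq hodd.add_one, zero_mul, norm_zero]
  -- the dual sum: only odd `m` contribute
  have hτ : ‖gaussSum χ (ZMod.stdAddChar (N := q))‖ = s := by
    rw [← Real.sqrt_sq (norm_nonneg _), Literature.NumberTheory.Sieve.LargeSieve.norm_gaussSum_sq hχ]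
  have hJnn : ∀ y : ℝ, 0 < y → 0 ≤ J y := fun y hy => vaalerJ_nonneg hΦ hJ hy
  have hT : ‖gaussSum χ (ZMod.stdAddChar (N := q)) / q *
      ∑ m ∈ Finset.range q, χ⁻¹ ((m + 1 : ℕ) : ZMod q) * (J ((m + 1) / (δ * q)) : ℂ)‖ ≤ 1 / 2 := by
    rw [norm_mul, norm_div, hτ, Complex.norm_natCast, hδq]
    have h1 : ‖∑ m ∈ Finset.range q, χ⁻¹ ((m + 1 : ℕ) : ZMod q) * (J ((m + 1) / s) : ℂ)‖
        ≤ ∑ m ∈ Finset.range q, ‖χ⁻¹ ((m + 1 : ℕ) : ZMod q)‖ * J ((m + 1) / s) := by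
      refine (norm_sum_le _ _).trans (Finset.sum_le_sum fun m _ => ?_)
      rw [norm_mul, Complex.norm_real, Real.norm_eq_abs, abs_of_nonneg (hJnn _ (by positivity))]
    have h2 := sum_norm_mul_le_sum_odd_points χ hq hJnn hs0
    have h3 := sum_vaalerJ_odd_le hΦ hJ hs0 q
    have h4 : s / q = 1 / s := by rw [← hsq]; field_simp
    rw [h4]
    calc 1 / s * ‖∑ m ∈ Finset.range q, χ⁻¹ ((m + 1 : ℕ) : ZMod q) * (J ((m + 1) / s) : ℂ)‖
        ≤ 1 / s * (s / 2) :=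
          mul_le_mul_of_nonneg_left (h1.trans (h2.trans h3)) (by positivity)
      _ = 1 / 2 := by field_simp
  have hlogδ : Real.log δ = -Real.log s := by rw [hδ, one_div, Real.log_inv]
  have hlogq : Real.log q = 2 * Real.log s := by
    rw [← hsq, Real.log_pow]; norm_num
  calc ‖χ.LFunction 1‖
      ≤ (-Real.log δ / 2 - 1 / 2 + Real.log 2 / 2) + 1 / 2 := by
        rw [hformula]; exact (norm_add_le _ _).trans (add_le_add hA hT)
    _ = Real.log q / 4 + Real.log 2 / 2 := by rw [hlogδ, hlogq]; ring

/-- **Ramaré 2001, Corollary 3 (odd characters):** for an odd primitive `χ` of EVEN conductor `q`,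
`|L(1,χ)| ≤ ¼ log q + 5/4 − ½ log 3` — Proposition 2 (`F₄ = 1 − K`) at `δ = 3/(π√q)`, the odd-`n`
smoothed sum `≤ −½ log πδ + ¾`, and the odd-point dual-sum bound `Σ_{m odd} (1 − m/(δq))₊² ≤ δq/6`.
[cite: Ramare2001LOneApproximateFormulae, Cor. 3 p. 248 / (7.3) p. 264] -/
theorem norm_LFunction_one_le_quarter_log_add_of_odd (hχ : χ.IsPrimitive) (hodd : χ.Odd)
    (hq : Even q) : ‖χ.LFunction 1‖ ≤ Real.log q / 4 + (5 / 4 - Real.log 3 / 2) := by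
  have hχ1 : χ ≠ 1 := by
    rintro rfl
    have h : (1 : DirichletCharacter ℂ q) (-1) = -1 := hodd
    rw [MulChar.one_apply (isUnit_one.neg)] at h
    norm_num at h
  have hqne : q ≠ 0 := NeZero.ne q
  have hq4 : 4 ≤ q := four_le_of_even_of_ne_one χ hq hχ1
  have hq0 : (0:ℝ) < q := by positivity
  have hq4' : (4:ℝ) ≤ q := by exact_mod_cast hq4
  set P : ℝ → ℝ := fun y => ∫ u in y..1, 2 * (1 - min u 1) with hP
  set s : ℝ := Real.sqrt q with hs
  have hs0 : 0 < s := Real.sqrt_pos.2 hq0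
  have hsq : s ^ 2 = q := Real.sq_sqrt hq0.le
  have hs2 : 2 ≤ s := by
    rw [hs, show (2:ℝ) = Real.sqrt (2 ^ 2) by rw [Real.sqrt_sq]; norm_num]
    exact Real.sqrt_le_sqrt (by linarith)
  have hπ3 : 3 < π := Real.pi_gt_three
  set δ : ℝ := 3 / (π * s) with hδ
  have hδ0 : 0 < δ := by positivity
  have hδ2 : δ < 1 / 2 := by
    rw [hδ, div_lt_iff₀ (by positivity)]; nlinarith
  have hδ1 : δ < 1 := by linarith
  have hδq : δ * q = 3 * s / π := by rw [hδ, ← hsq]; field_simp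
  have hπδ : π * δ = 3 / s := by rw [hδ]; field_simp
  have hformula := LFunction_one_eq_fejer_add_dual χ hχ hχ1 hodd hP hδ0 hδ1
  -- the smoothed sum: only odd `n` contribute
  obtain ⟨A, hAsum, hAle⟩ := exists_hasSum_sinc_sq_div_odd_le hδ0 hδ2
  have hA : ‖∑' n : ℕ, χ ((n + 1 : ℕ) : ZMod q) *
      ((Real.sinc (π * (δ * (n + 1))) ^ 2 / (n + 1) : ℝ) : ℂ)‖ ≤ -Real.log (π * δ) / 2 + 3 / 4 := by
    refine (tsum_of_norm_bounded hAsum fun n => ?_).trans hAle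
    have hwn : 0 ≤ Real.sinc (π * (δ * (n + 1))) ^ 2 / ((n:ℝ) + 1) := by positivity
    by_cases hn : Even n
    · rw [if_pos hn, norm_mul, Complex.norm_real, Real.norm_eq_abs, abs_of_nonneg hwn]
      exact mul_le_of_le_one_left hwn (χ.norm_le_one _)
    · rw [if_neg hn]
      have hodd' : Odd n := Nat.not_even_iff_odd.1 hn
      rw [apply_natCast_eq_zero_of_even χ hq hodd'.add_one, zero_mul, norm_zero]
  -- the dual sum: only odd `m` contribute
  have hτ : ‖gaussSum χ (ZMod.stdAddChar (N := q))‖ = s := by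
    rw [← Real.sqrt_sq (norm_nonneg _), Literature.NumberTheory.Sieve.LargeSieve.norm_gaussSum_sq hχ]
  have hPnn : ∀ y : ℝ, 0 < y → 0 ≤ P y := fun y _ => fejerDualP_nonneg hP y
  have hα0 : 0 < 3 * s / π := by positivity
  have hT : ‖(π * Complex.I * gaussSum χ (ZMod.stdAddChar (N := q)) / q) *
      ∑ m ∈ Finset.range q, χ⁻¹ ((m + 1 : ℕ) : ZMod q) * (P ((m + 1) / (δ * q)) : ℂ)‖ ≤ 1 / 2 := by
    rw [norm_mul, norm_div, norm_mul, norm_mul, hτ, Complex.norm_real, Complex.norm_I,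
      Complex.norm_natCast, Real.norm_eq_abs, abs_of_pos Real.pi_pos, mul_one, hδq]
    have h1 : ‖∑ m ∈ Finset.range q, χ⁻¹ ((m + 1 : ℕ) : ZMod q) * (P ((m + 1) / (3 * s / π)) : ℂ)‖
        ≤ ∑ m ∈ Finset.range q, ‖χ⁻¹ ((m + 1 : ℕ) : ZMod q)‖ * P ((m + 1) / (3 * s / π)) := by
      refine (norm_sum_le _ _).trans (Finset.sum_le_sum fun m _ => ?_)
      rw [norm_mul, Complex.norm_real, Real.norm_eq_abs, abs_of_nonneg (hPnn _ (by positivity))]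
    have h2 := sum_norm_mul_le_sum_odd_points χ hq hPnn hα0
    have h3 := sum_fejerDualP_odd_le hP hα0 q
    have h4 : π * s / q = π / s := by rw [← hsq]; field_simp
    rw [h4]
    calc π / s * ‖∑ m ∈ Finset.range q, χ⁻¹ ((m + 1 : ℕ) : ZMod q) * (P ((m + 1) / (3 * s / π)) : ℂ)‖
        ≤ π / s * (3 * s / π / 6) :=
          mul_le_mul_of_nonneg_left (h1.trans (h2.trans h3)) (by positivity)
      _ = 1 / 2 := by field_simp; ring
  have hlog3s : Real.log (π * δ) = Real.log 3 - Real.log s := by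
    rw [hπδ, Real.log_div three_ne_zero hs0.ne']
  have hlogq : Real.log q = 2 * Real.log s := by
    rw [← hsq, Real.log_pow]; norm_num
  calc ‖χ.LFunction 1‖
      ≤ (-Real.log (π * δ) / 2 + 3 / 4) + 1 / 2 := by
        rw [hformula]; exact (norm_sub_le _ _).trans (add_le_add hA hT)
    _ = Real.log q / 4 + (5 / 4 - Real.log 3 / 2) := by rw [hlog3s, hlogq]; ring

/-- **Ramaré 2001, Corollary 3** in the quantified shape of the named fact `ramare2001_corollary3`
(`ExplicitLOneUpperBounds.lean`). [cite: Ramare2001LOneApproximateFormulae, Cor. 3 p. 248] -/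
theorem ramare2001_corollary3' :
    ∀ (q : ℕ) [NeZero q] (χ : DirichletCharacter ℂ q), χ.IsPrimitive → χ ≠ 1 → Even q →
      (χ.Even → ‖χ.LFunction 1‖ ≤ Real.log q / 4 + Real.log 2 / 2) ∧
      (χ.Odd → ‖χ.LFunction 1‖ ≤ Real.log q / 4 + (5 / 4 - Real.log 3 / 2)) :=
  fun _ _ χ hχ hχ1 hq =>
    ⟨fun heven => norm_LFunction_one_le_quarter_log_add_of_even χ hχ hχ1 heven hq,
     fun hodd => norm_LFunction_one_le_quarter_log_add_of_odd χ hχ hodd hq⟩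

end Corollary

end Literature.NumberTheory.LFunctions.Ramare2001
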